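import Summits.BirchSwinnertonDyer.BirchSwinnertonDyer.Theorems.ResidualThetaTransportAtTwoSignedMuVanishingAtTwoPlusCuspSpanGroup
import Mathlib.GroupTheory.Abelianization.Defs
import HarnessLib

/-!
# Route `ResidualThetaTransportAtTwo`, crux Kμ⁺ `SignedMuVanishingAtTwoPlus` (stmt-BirchSwinnertonDyer-20689),
# line `birth`, stub `stub_flatMuZeroAtTwo`: the spanning hypothesis as ONE SUBGROUP INCLUSION in `Γ₀(N)` —
# (G″)_N ⟺ `Γ₁'(N) ≤ M_N`, `M_N` = the subgroup generated by the small-trace elements, the `4^k`-classes,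
# the squares and the commutators

Cell `bsd-wall`, width seat `bsd-wall-rtt-p4-w3` (g3). THEOREMS ONLY (no `def`, no named fact, no `sorry`); helper
`--supports` the crux; every spanning statement is a HYPOTHESIS, spelled inline; BSD is not proved by this. Sequel of
this seat's `…CuspSpanGroup` (p594698: the trace form (G″)_N ⟹ lead g5's period form (G′)_N ⟹ FLAT).

* §1 `exists_gamma0_cast_apply_one_one_eq` — `γ ↦ d(γ) mod N` maps `Γ₀(N)` ONTO the units of `ZMod N` (Bézout).
* §2 `cuspSpanTrace_of_gamma1_le_closure` — **MEMBERSHIP FORM ⟹ (G″)_N**: if every `γ ∈ Γ₀(N)` with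
  `d(γ) ≡ 1 (mod N)` (Mathlib's `Gamma1' N = ker Gamma0Map`) lies in the subgroup `M_N` of `Γ₀(N)` generated by
  `E = {|tr γ| ≤ 2}` (`±1`, elliptic, parabolic), `T = {|d(γ)| = 4^k, k ≥ 1}`, the squares `{g²}` and the commutators
  (`commutatorSet`), then every additive `χ : Γ₀(N) → ZMod 2` killing `E ∪ T` is `ψ ∘ d` (`χ` kills `M_N`, hence is
  constant on the fibres of `d`; `ψ` := the common value, multiplicative by §1). This is the shape a computational
  group-theory certificate for a level `N` takes: finitely many words. `flatAtTwo_of_gamma1_le_closure`: the inclusion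
  at `N = N_W` ⟹ FLAT at `(W, f)` on the habitat⁺ (through `flatAtTwo_of_cuspSpanTrace`).
* §3 `gamma1_le_closure_of_cuspSpanTrace` — **the converse, (G″)_N ⟹ `Γ₁'(N) ≤ M_N`** (so NOTHING is lost):
  `M_N ⊇ [Γ₀(N), Γ₀(N)]·Γ₀(N)²`, so `Γ₀(N)/M_N` is an `𝔽₂`-vector space (realised inside `Γ₀(N)ᵃᵇ ⊗ 𝔽₂` =
  `Additive (Abelianization Γ₀(N))` modulo the image of `M_N`), whose linear functionals separate points
  (`Module.Projective.exists_dual_ne_zero`); a functional not vanishing at the class of a `γ ∈ Γ₁'(N) ∖ M_N` would be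
  an additive `χ` killing `E ∪ T` with `χ γ ≠ 0 = ψ(1)`. `cuspSpanTrace_iff_gamma1_le_closure` records the
  equivalence.

So the class-wide research residue of the analytic stub (mod Abbes–Ullmo) reads: for every odd `N`, `Γ₁'(N) ≤ M_N`
— one inclusion of subgroups of `SL(2, ℤ)` per level (lead g4's (G′)_N in `π₁`-form; verified numerically by Manin
symbols for all odd `N ≤ 2999`, `FlatCuspSpan.md` §4; OPEN in general).

References: A. W. Knapp, *Elliptic curves* (1992) Prop. 11.1, Prop. 11.22 [Knapp1993]; G. Shimura, *Introduction to
the arithmetic theory of automorphic functions* (1971) §1.2, §8.1 [ShimuraIATAF1971]; R. Pollack, Duke Math. J. 118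
(2003) Conj. 6.3, Prop. 6.18 [Pollack2003].
-/

set_option autoImplicit false
set_option linter.dupNamespace false

noncomputable section

open scoped Classical MatrixGroups ModularForm

open CongruenceSubgroup WeierstrassCurve Literature.NumberTheory.EllipticCurves
  Literature.NumberTheory.EllipticCurves.ModularForms Literature.NumberTheory.EllipticCurves.Rank1Residual
  Literature.NumberTheory.IwasawaTheory Summit.BirchSwinnertonDyer.Rank1Residual.Supersingular
  Summit.BirchSwinnertonDyer.BirchSwinnertonDyer.Theses.ResidualThetaTransportAtTwo

namespace Summit.BirchSwinnertonDyer.BirchSwinnertonDyer.Theorems.SignedMuAtTwo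

/-! ## §1. `d : Γ₀(N) → (ℤ/N)ˣ` is onto -/

section Surjective

variable {N : ℕ} [NeZero N]

/-- **Every unit of `ZMod N` is the lower-right entry of an element of `Γ₀(N)`**: for `x` a unit, `d := x.val` is
prime to `N`, Bézout gives `a d + b N = 1`, and `(a −b; N d) ∈ Γ₀(N)`. [folklore] -/
theorem exists_gamma0_cast_apply_one_one_eq {x : ZMod N} (hx : IsUnit x) :
    ∃ γ : Gamma0 N, ((((γ : SL(2, ℤ)) 1 1 : ℤ) : ZMod N)) = x := by
  have hcop : Nat.Coprime x.val N := by
    have h := ZMod.val_coe_unit_coprime hx.unit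
    rwa [IsUnit.unit_spec] at h
  obtain ⟨a, b, hab⟩ : IsCoprime (x.val : ℤ) (N : ℤ) := Nat.isCoprime_iff_coprime.mpr hcop
  refine ⟨⟨⟨!![a, -b; (N : ℤ), (x.val : ℤ)], ?_⟩, ?_⟩, ?_⟩
  · rw [Matrix.det_fin_two_of]
    linear_combination hab
  · rw [Gamma0_mem]
    change (((N : ℕ) : ℤ) : ZMod N) = 0
    rw [Int.cast_natCast, ZMod.natCast_self]
  · change (((x.val : ℕ) : ℤ) : ZMod N) = x
    rw [Int.cast_natCast, ZMod.natCast_zmod_val]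

end Surjective

/-! ## §2. The membership form `Γ₁'(N) ≤ M_N` implies (G″)_N -/

section Membership

variable {N : ℕ}

/-- An additive `ZMod 2`-valued function on a group kills `1`. [folklore] -/
theorem map_one_eq_zero_of_additive {G : Type*} [Group G] {χ : G → ZMod 2}
    (hadd : ∀ γ δ : G, χ (γ * δ) = χ γ + χ δ) : χ 1 = 0 := by
  have h := hadd 1 1
  rw [mul_one] at h
  linear_combination (-1 : ZMod 2) * h

/-- An additive `ZMod 2`-valued function on a group satisfies `χ γ⁻¹ = χ γ`. [folklore] -/
theorem map_inv_eq_of_additive {G : Type*} [Group G] {χ : G → ZMod 2}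
    (hadd : ∀ γ δ : G, χ (γ * δ) = χ γ + χ δ) (γ : G) : χ γ⁻¹ = χ γ := by
  have h := hadd γ γ⁻¹
  rw [mul_inv_cancel, map_one_eq_zero_of_additive hadd] at h
  have : χ γ⁻¹ = -χ γ := by linear_combination (-1 : ZMod 2) * h
  rw [this, ZMod.neg_eq_self_mod_two]

/-- **An additive `χ : Γ₀(N) → ZMod 2` killing the small-trace elements and the `4^k`-classes kills the whole
subgroup `M_N`** generated by them together with the squares and the commutators (`χ(g²) = 2χ(g) = 0`,
`χ[g₁, g₂] = 2χ(g₁) + 2χ(g₂) = 0`). [folklore] -/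
theorem eq_zero_of_mem_closure {χ : Gamma0 N → ZMod 2}
    (hadd : ∀ γ δ : Gamma0 N, χ (γ * δ) = χ γ + χ δ)
    (hsmall : ∀ γ : Gamma0 N, ((γ : SL(2, ℤ)) 0 0 + (γ : SL(2, ℤ)) 1 1).natAbs ≤ 2 → χ γ = 0)
    (hkill : ∀ γ : Gamma0 N, (∃ k : ℕ, 1 ≤ k ∧ ((γ : SL(2, ℤ)) 1 1).natAbs = 4 ^ k) → χ γ = 0)
    {γ : Gamma0 N}
    (hγ : γ ∈ Subgroup.closure
      ({γ : Gamma0 N | ((γ : SL(2, ℤ)) 0 0 + (γ : SL(2, ℤ)) 1 1).natAbs ≤ 2} ∪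
        {γ : Gamma0 N | ∃ k : ℕ, 1 ≤ k ∧ ((γ : SL(2, ℤ)) 1 1).natAbs = 4 ^ k} ∪
        {γ : Gamma0 N | ∃ g : Gamma0 N, g * g = γ} ∪ commutatorSet (Gamma0 N))) :
    χ γ = 0 := by
  have h2 : ∀ z : ZMod 2, z + z = 0 := by decide
  induction hγ using Subgroup.closure_induction with
  | mem s hs =>
    rcases hs with ((hs | hs) | hs) | hs
    · exact hsmall s hs
    · exact hkill s hs
    · obtain ⟨g, rfl⟩ := hs
      rw [hadd, h2]
    · obtain ⟨g₁, g₂, rfl⟩ := hs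
      rw [commutatorElement_def, hadd, hadd, hadd, map_inv_eq_of_additive hadd, map_inv_eq_of_additive hadd]
      have : χ g₁ + χ g₂ + χ g₁ + χ g₂ = (χ g₁ + χ g₂) + (χ g₁ + χ g₂) := by ring
      rw [this, h2]
  | one => exact map_one_eq_zero_of_additive hadd
  | mul x y _ _ hx hy => rw [hadd, hx, hy, add_zero]
  | inv x _ hx => rw [map_inv_eq_of_additive hadd, hx]

variable [NeZero N]

/-- **MEMBERSHIP FORM ⟹ (G″)_N.** Suppose every `γ ∈ Γ₀(N)` with `d(γ) ≡ 1 (mod N)` (`Gamma1' N`) lies in the subgroup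
`M_N ≤ Γ₀(N)` generated by the elements of trace `0, ±1, ±2`, the elements with lower-right entry `±4^k` (`k ≥ 1`),
the squares and the commutators. Then every additive `χ : Γ₀(N) → ZMod 2` killing the small-trace elements and the
`4^k`-classes is `ψ ∘ d` for a `ψ : ZMod N → ZMod 2` multiplicative on units: `χ` kills `M_N ⊇ Γ₁'(N)`, so it is
constant on the fibres of `d : Γ₀(N) → (ℤ/N)ˣ` (onto, §1), and `ψ` is the induced function. This is lead g4's (G′)_N as
ONE inclusion of subgroups of `SL(2, ℤ)` — the shape of a per-level group-theoretic certificate (finitely many words).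
[cite: Knapp1993, Prop. 11.22] [cite: Pollack2003, Conj. 6.3] -/
theorem cuspSpanTrace_of_gamma1_le_closure
    (hM : Gamma1' N ≤ Subgroup.closure
      ({γ : Gamma0 N | ((γ : SL(2, ℤ)) 0 0 + (γ : SL(2, ℤ)) 1 1).natAbs ≤ 2} ∪
        {γ : Gamma0 N | ∃ k : ℕ, 1 ≤ k ∧ ((γ : SL(2, ℤ)) 1 1).natAbs = 4 ^ k} ∪
        {γ : Gamma0 N | ∃ g : Gamma0 N, g * g = γ} ∪ commutatorSet (Gamma0 N))) :
    ∀ χ : Gamma0 N → ZMod 2,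
      (∀ γ δ : Gamma0 N, χ (γ * δ) = χ γ + χ δ) →
      (∀ γ : Gamma0 N, ((γ : SL(2, ℤ)) 0 0 + (γ : SL(2, ℤ)) 1 1).natAbs ≤ 2 → χ γ = 0) →
      (∀ γ : Gamma0 N, (∃ k : ℕ, 1 ≤ k ∧ ((γ : SL(2, ℤ)) 1 1).natAbs = 4 ^ k) → χ γ = 0) →
      ∃ ψ : ZMod N → ZMod 2, (∀ x y : ZMod N, IsUnit x → IsUnit y → ψ (x * y) = ψ x + ψ y) ∧
        ∀ γ : Gamma0 N, χ γ = ψ ((((γ : SL(2, ℤ)) 1 1 : ℤ) : ZMod N)) := by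
  intro χ hadd hsmall hkill
  -- `χ` is constant on the fibres of `d`
  have hdep : ∀ γ δ : Gamma0 N,
      ((((γ : SL(2, ℤ)) 1 1 : ℤ) : ZMod N)) = ((((δ : SL(2, ℤ)) 1 1 : ℤ) : ZMod N)) → χ γ = χ δ := by
    intro γ δ h
    have hmem : δ⁻¹ * γ ∈ Gamma1' N := by
      rw [Gamma1_mem']
      change ((((δ⁻¹ * γ : Gamma0 N) : SL(2, ℤ)) 1 1 : ℤ) : ZMod N) = 1
      rw [cast_mul_apply_one_one, coe_inv_apply_one_one, h, mul_comm]
      exact gamma0_apply_one_one_mul_apply_zero_zero δ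
    have h0 := eq_zero_of_mem_closure hadd hsmall hkill (hM hmem)
    rw [hadd, map_inv_eq_of_additive hadd] at h0
    have : χ γ = -χ δ := by linear_combination h0
    rw [this, ZMod.neg_eq_self_mod_two]
  -- the induced function on `ZMod N`
  refine ⟨fun x ↦ if h : ∃ γ : Gamma0 N, ((((γ : SL(2, ℤ)) 1 1 : ℤ) : ZMod N)) = x then χ h.choose else 0,
    ?_, ?_⟩
  · -- multiplicative on units
    have hval : ∀ γ : Gamma0 N,
        (fun x : ZMod N ↦ if h : ∃ γ : Gamma0 N, ((((γ : SL(2, ℤ)) 1 1 : ℤ) : ZMod N)) = x then χ h.choose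
          else 0) ((((γ : SL(2, ℤ)) 1 1 : ℤ) : ZMod N)) = χ γ := by
      intro γ
      have hex : ∃ γ' : Gamma0 N, ((((γ' : SL(2, ℤ)) 1 1 : ℤ) : ZMod N)) = ((((γ : SL(2, ℤ)) 1 1 : ℤ) : ZMod N)) :=
        ⟨γ, rfl⟩
      simp only [dif_pos hex]
      exact hdep _ _ hex.choose_spec
    intro x y hx hy
    obtain ⟨γx, hγx⟩ := exists_gamma0_cast_apply_one_one_eq hx
    obtain ⟨γy, hγy⟩ := exists_gamma0_cast_apply_one_one_eq hy
    rw [← hγx, ← hγy, ← cast_mul_apply_one_one, hval, hval, hval, hadd]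
  · intro γ
    have hex : ∃ γ' : Gamma0 N, ((((γ' : SL(2, ℤ)) 1 1 : ℤ) : ZMod N)) = ((((γ : SL(2, ℤ)) 1 1 : ℤ) : ZMod N)) :=
      ⟨γ, rfl⟩
    simp only [dif_pos hex]
    exact (hdep _ _ hex.choose_spec).symm

variable {W : WeierstrassCurve ℚ} [W.IsElliptic] [W.IsGloballyMinimal]

/-- **`Γ₁'(N_W) ≤ M_{N_W}` ⟹ FLAT at `(W, f)`.** For `W/ℚ` good supersingular at `2` with `a₂(W) = 0` and its newform
`f`: if every element of `Γ₀(N_W)` with lower-right entry `≡ 1 (mod N_W)` is a product of elements of trace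
`0, ±1, ±2`, elements with lower-right entry `±4^k` (`k ≥ 1`), squares and commutators of `Γ₀(N_W)`, then `2 ∤ L♭`
for every Pollack pair `(L♯, L♭)` of `f` at `2`. The inclusion is a HYPOTHESIS (lead g4's (G′)_{N_W} in
`π₁`-form); BSD is not proved by this. [cite: Pollack2003, Conj. 6.3 and Prop. 6.18] [cite: Knapp1993, Prop. 11.1, Prop. 11.22] -/
theorem flatAtTwo_of_gamma1_le_closure [NeZero (W.conductorNorm ℤ)]
    {f : CuspForm (Gamma0 (W.conductorNorm ℤ)) 2} (hf : IsNewformOf W f) (hss : GoodSS W 2)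
    (ha : W.frobeniusTrace 2 = 0)
    (hM : Gamma1' (W.conductorNorm ℤ) ≤ Subgroup.closure
      ({γ : Gamma0 (W.conductorNorm ℤ) | ((γ : SL(2, ℤ)) 0 0 + (γ : SL(2, ℤ)) 1 1).natAbs ≤ 2} ∪
        {γ : Gamma0 (W.conductorNorm ℤ) | ∃ k : ℕ, 1 ≤ k ∧ ((γ : SL(2, ℤ)) 1 1).natAbs = 4 ^ k} ∪
        {γ : Gamma0 (W.conductorNorm ℤ) | ∃ g : Gamma0 (W.conductorNorm ℤ), g * g = γ} ∪
        commutatorSet (Gamma0 (W.conductorNorm ℤ)))) :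
    ∀ Lplus Lminus : IwasawaAlgebra 2, IsPollackPair f 2 Lplus Lminus → ¬ PowerSeries.C (2 : ℤ_[2]) ∣ Lminus :=
  flatAtTwo_of_cuspSpanTrace hf hss ha (cuspSpanTrace_of_gamma1_le_closure hM)

/-- **`Γ₁'(N) ≤ M_N` for every odd `N` ⟹ the registered stub `FlatMuZeroAtTwo` of line `birth`** (verbatim). The
hypothesis is one inclusion of subgroups of `Γ₀(N)` per odd level and nothing else; BSD is not proved by this.
[cite: Pollack2003, Conj. 6.3 and Prop. 6.18] -/
theorem flatMuZeroAtTwo_of_gamma1_le_closure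
    (hM : ∀ (N : ℕ) [NeZero N], ¬ 2 ∣ N → Gamma1' N ≤ Subgroup.closure
      ({γ : Gamma0 N | ((γ : SL(2, ℤ)) 0 0 + (γ : SL(2, ℤ)) 1 1).natAbs ≤ 2} ∪
        {γ : Gamma0 N | ∃ k : ℕ, 1 ≤ k ∧ ((γ : SL(2, ℤ)) 1 1).natAbs = 4 ^ k} ∪
        {γ : Gamma0 N | ∃ g : Gamma0 N, g * g = γ} ∪ commutatorSet (Gamma0 N))) :
    ∀ (W : WeierstrassCurve ℚ) [W.IsElliptic] [W.IsGloballyMinimal], ¬ W.HasCM → W.analyticRank = 0 →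
      GoodSS W 2 → W.frobeniusTrace 2 = 0 → W.Δ < 0 →
      ∀ [NeZero (W.conductorNorm ℤ)] (f : CuspForm (Gamma0 (W.conductorNorm ℤ)) 2), IsNewformOf W f →
      ∀ (Lplus Lminus : IwasawaAlgebra 2), IsPollackPair f 2 Lplus Lminus → ¬ PowerSeries.C (2 : ℤ_[2]) ∣ Lminus :=
  flatMuZeroAtTwo_of_cuspSpanTrace fun N _ hN ↦ cuspSpanTrace_of_gamma1_le_closure (hM N hN)

/-- **`Γ₁'(N) ≤ M_N` for every odd `N` ∧ Abbes–Ullmo Thm A (by name) ⟹ the analytic child 21437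
`SignedMuAnalyticAtTwoPlus`.** Conditional on the print fact `abbesUllmo_not_dvd_maninConstant_of_not_dvd_level` and on
the subgroup inclusions; BSD is not proved by this. [cite: AbbesUllmo1996, Thm. A] [cite: Pollack2003, Conj. 6.3 and Prop. 6.18] -/
theorem signedMuAnalyticAtTwoPlus_of_abbesUllmo_of_gamma1_le_closure
    (hAU : abbesUllmo_not_dvd_maninConstant_of_not_dvd_level)
    (hM : ∀ (N : ℕ) [NeZero N], ¬ 2 ∣ N → Gamma1' N ≤ Subgroup.closure
      ({γ : Gamma0 N | ((γ : SL(2, ℤ)) 0 0 + (γ : SL(2, ℤ)) 1 1).natAbs ≤ 2} ∪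
        {γ : Gamma0 N | ∃ k : ℕ, 1 ≤ k ∧ ((γ : SL(2, ℤ)) 1 1).natAbs = 4 ^ k} ∪
        {γ : Gamma0 N | ∃ g : Gamma0 N, g * g = γ} ∪ commutatorSet (Gamma0 N))) :
    SignedMuAnalyticAtTwoPlus :=
  signedMuAnalyticAtTwoPlus_of_abbesUllmo_of_cuspSpanTrace hAU fun N _ hN ↦
    cuspSpanTrace_of_gamma1_le_closure (hM N hN)

end Membership

/-! ## §3. The converse: (G″)_N ⟹ `Γ₁'(N) ≤ M_N`; the equivalence -/

section Converse

variable {N : ℕ} [NeZero N]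

omit [NeZero N] in
/-- **(G″)_N ⟹ `Γ₁'(N) ≤ M_N`.** If every additive `χ : Γ₀(N) → ZMod 2` killing the small-trace elements and the
`4^k`-classes is `ψ ∘ d` (`ψ` multiplicative on units), then every `γ ∈ Γ₀(N)` with `d(γ) ≡ 1 (mod N)` lies in the
subgroup `M_N` generated by the small-trace elements, the `4^k`-classes, the squares and the commutators. Proof:
`M_N ⊇ [Γ₀(N), Γ₀(N)]` and `M_N ⊇ Γ₀(N)²`, so the image of `M_N` in `Additive (Γ₀(N)ᵃᵇ)` has an `𝔽₂`-vector space
quotient `V`; if `γ ∉ M_N` its class in `V` is non-zero, a linear functional `φ` with `φ[γ] ≠ 0` exists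
(`Module.Projective.exists_dual_ne_zero`), and `χ := φ ∘ [·]` is additive, kills `M_N ⊇ E ∪ T`, but
`χ γ = ψ(d γ) = ψ(1) = 0` — contradiction. [cite: Knapp1993, Prop. 11.22] [cite: Pollack2003, Conj. 6.3] -/
theorem gamma1_le_closure_of_cuspSpanTrace
    (hG : ∀ χ : Gamma0 N → ZMod 2,
      (∀ γ δ : Gamma0 N, χ (γ * δ) = χ γ + χ δ) →
      (∀ γ : Gamma0 N, ((γ : SL(2, ℤ)) 0 0 + (γ : SL(2, ℤ)) 1 1).natAbs ≤ 2 → χ γ = 0) →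
      (∀ γ : Gamma0 N, (∃ k : ℕ, 1 ≤ k ∧ ((γ : SL(2, ℤ)) 1 1).natAbs = 4 ^ k) → χ γ = 0) →
      ∃ ψ : ZMod N → ZMod 2, (∀ x y : ZMod N, IsUnit x → IsUnit y → ψ (x * y) = ψ x + ψ y) ∧
        ∀ γ : Gamma0 N, χ γ = ψ ((((γ : SL(2, ℤ)) 1 1 : ℤ) : ZMod N))) :
    Gamma1' N ≤ Subgroup.closure
      ({γ : Gamma0 N | ((γ : SL(2, ℤ)) 0 0 + (γ : SL(2, ℤ)) 1 1).natAbs ≤ 2} ∪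
        {γ : Gamma0 N | ∃ k : ℕ, 1 ≤ k ∧ ((γ : SL(2, ℤ)) 1 1).natAbs = 4 ^ k} ∪
        {γ : Gamma0 N | ∃ g : Gamma0 N, g * g = γ} ∪ commutatorSet (Gamma0 N)) := by
  set M : Subgroup (Gamma0 N) := Subgroup.closure
      ({γ : Gamma0 N | ((γ : SL(2, ℤ)) 0 0 + (γ : SL(2, ℤ)) 1 1).natAbs ≤ 2} ∪
        {γ : Gamma0 N | ∃ k : ℕ, 1 ≤ k ∧ ((γ : SL(2, ℤ)) 1 1).natAbs = 4 ^ k} ∪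
        {γ : Gamma0 N | ∃ g : Gamma0 N, g * g = γ} ∪ commutatorSet (Gamma0 N)) with hMdef
  intro γ hγ
  by_contra hγM
  -- the abelianisation, the image `S` of `M`, and the `𝔽₂`-vector space `Additive (Γ₀(N)ᵃᵇ) ⧸ S`
  set π : Gamma0 N →* Abelianization (Gamma0 N) := Abelianization.of with hπ
  set S : AddSubgroup (Additive (Abelianization (Gamma0 N))) := (M.map π).toAddSubgroup with hS
  have hmemS : ∀ g : Gamma0 N, g ∈ M → (Additive.ofMul (π g) : Additive (Abelianization (Gamma0 N))) ∈ S := by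
    intro g hg
    rw [hS, Additive.mem_toAddSubgroup, toMul_ofMul]
    exact ⟨g, hg, rfl⟩
  have h2 : ∀ x : Additive (Abelianization (Gamma0 N)), 2 • x ∈ S := by
    intro x
    obtain ⟨g, hg⟩ : ∃ g : Gamma0 N, Additive.ofMul (π g) = x := by
      induction x using Additive.rec with
      | ofMul a =>
        induction a using QuotientGroup.induction_on with
        | H g => exact ⟨g, rfl⟩
    rw [← hg, two_nsmul, ← ofMul_mul, ← map_mul]
    exact hmemS _ (Subgroup.subset_closure (Or.inl (Or.inr ⟨g, rfl⟩)))
  letI : Module (ZMod 2) (Additive (Abelianization (Gamma0 N)) ⧸ S) := QuotientAddGroup.zmodModule h2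
  -- the class of `γ` is non-zero
  have hv0 : (QuotientAddGroup.mk (Additive.ofMul (π γ)) : Additive (Abelianization (Gamma0 N)) ⧸ S) ≠ 0 := by
    intro h0
    rw [QuotientAddGroup.eq_zero_iff, hS, Additive.mem_toAddSubgroup, toMul_ofMul, Subgroup.mem_map] at h0
    obtain ⟨m, hmM, hm⟩ := h0
    have hker : m⁻¹ * γ ∈ commutator (Gamma0 N) := by
      rw [← Abelianization.ker_of, MonoidHom.mem_ker, map_mul, map_inv, ← hπ, hm, inv_mul_cancel]
    have hcomm : commutator (Gamma0 N) ≤ M := by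
      rw [commutator_eq_closure, hMdef]
      exact Subgroup.closure_mono Set.subset_union_right
    apply hγM
    have := M.mul_mem hmM (hcomm hker)
    rwa [mul_inv_cancel_left] at this
  -- a linear functional separating it
  obtain ⟨φ, hφ⟩ := Module.Projective.exists_dual_ne_zero (ZMod 2) hv0
  -- the character `χ = φ ∘ [·]`
  set χ : Gamma0 N → ZMod 2 := fun g ↦
    φ (QuotientAddGroup.mk (Additive.ofMul (π g)) : Additive (Abelianization (Gamma0 N)) ⧸ S) with hχ
  have hadd : ∀ g h : Gamma0 N, χ (g * h) = χ g + χ h := by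
    intro g h
    simp only [hχ, map_mul, ofMul_mul, QuotientAddGroup.mk_add, map_add]
  have hkillM : ∀ g ∈ M, χ g = 0 := by
    intro g hg
    have h0 : (QuotientAddGroup.mk (Additive.ofMul (π g)) : Additive (Abelianization (Gamma0 N)) ⧸ S) = 0 := by
      rw [QuotientAddGroup.eq_zero_iff]
      exact hmemS g hg
    simp only [hχ, h0, map_zero]
  obtain ⟨ψ, hψ, hχψ⟩ := hG χ hadd
    (fun g hg ↦ hkillM g (Subgroup.subset_closure (Or.inl (Or.inl (Or.inl hg)))))
    (fun g hg ↦ hkillM g (Subgroup.subset_closure (Or.inl (Or.inl (Or.inr hg)))))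
  -- evaluate at `γ ∈ Γ₁'(N)`: `χ γ = ψ 1 = 0`
  have hd : ((((γ : SL(2, ℤ)) 1 1 : ℤ) : ZMod N)) = 1 := by
    rw [Gamma1_mem'] at hγ
    exact hγ
  have : χ γ = 0 := by rw [hχψ γ, hd, map_one_eq_zero_of_mul_on_units hψ]
  exact hφ this

/-- **(G″)_N ⟺ `Γ₁'(N) ≤ M_N`**: the analysis-free spanning hypothesis of `…CuspSpanGroup` (every additive
`ZMod 2`-character of `Γ₀(N)` killing the elements of trace `0, ±1, ±2` and the elements with `|d| = 4^k`, `k ≥ 1`, is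
`ψ ∘ d`) is EQUIVALENT to one inclusion of subgroups of `Γ₀(N)`: every `γ` with `d(γ) ≡ 1 (mod N)` is a product of
small-trace elements, `4^k`-elements, squares and commutators. So the class-wide research residue of the analytic
stub is «`Γ₁'(N) ≤ M_N` for every odd `N`» (open; verified by Manin symbols for all odd `N ≤ 2999` with `g ≥ 1`,
lead g4's `FlatCuspSpan.md` §4). [cite: Knapp1993, Prop. 11.22] [cite: Pollack2003, Conj. 6.3] -/
theorem cuspSpanTrace_iff_gamma1_le_closure :
    (∀ χ : Gamma0 N → ZMod 2,
      (∀ γ δ : Gamma0 N, χ (γ * δ) = χ γ + χ δ) →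
      (∀ γ : Gamma0 N, ((γ : SL(2, ℤ)) 0 0 + (γ : SL(2, ℤ)) 1 1).natAbs ≤ 2 → χ γ = 0) →
      (∀ γ : Gamma0 N, (∃ k : ℕ, 1 ≤ k ∧ ((γ : SL(2, ℤ)) 1 1).natAbs = 4 ^ k) → χ γ = 0) →
      ∃ ψ : ZMod N → ZMod 2, (∀ x y : ZMod N, IsUnit x → IsUnit y → ψ (x * y) = ψ x + ψ y) ∧
        ∀ γ : Gamma0 N, χ γ = ψ ((((γ : SL(2, ℤ)) 1 1 : ℤ) : ZMod N))) ↔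
    Gamma1' N ≤ Subgroup.closure
      ({γ : Gamma0 N | ((γ : SL(2, ℤ)) 0 0 + (γ : SL(2, ℤ)) 1 1).natAbs ≤ 2} ∪
        {γ : Gamma0 N | ∃ k : ℕ, 1 ≤ k ∧ ((γ : SL(2, ℤ)) 1 1).natAbs = 4 ^ k} ∪
        {γ : Gamma0 N | ∃ g : Gamma0 N, g * g = γ} ∪ commutatorSet (Gamma0 N)) :=
  ⟨gamma1_le_closure_of_cuspSpanTrace, cuspSpanTrace_of_gamma1_le_closure⟩

end Converse

end Summit.BirchSwinnertonDyer.BirchSwinnertonDyer.Theorems.SignedMuAtTwo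

end
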